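import Literature.Geometry.DiscreteGeometry.ThreePointBoundGeneral
import Summits.Ventures.PackingBounds.Energy.TenPointCkElevenFacc1
import Summits.Ventures.PackingBounds.Energy.TenPointCkElevenFgrp2
import Summits.Ventures.PackingBounds.Energy.TenPointCkElevenFblk0
import Summits.Ventures.PackingBounds.Energy.TenPointCkElevenFblk1
import Summits.Ventures.PackingBounds.Energy.TenPointCkElevenFblk2
import Summits.Ventures.PackingBounds.Energy.TenPointCkElevenFblk3
import Summits.Ventures.PackingBounds.Energy.TenPointCkElevenFblk4
import Summits.Ventures.PackingBounds.Energy.TenPointCkElevenFblk5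
import HarnessLib

/-!
# `TenPointCkEleven`: the tree's factored three-point function `threePointF 4 6 6 dcoKT11 gwKT11` equals the expansion `FexpKT11`

Framing: lottery ticket; floor = certified bounds/negative ranges. Venture `PackingBounds`, cell
`pub-packcert`, energy family E3PT (pub-packcert-energy gen 13; n = 4 kernel route = KERNEL-D6 data route + `threePointF 4`).
-/

noncomputable section

open Finset

namespace Summit.Ventures.PackingBounds.Energy.TenPointCkEleven

open Literature.Geometry.DiscreteGeometry Literature.Geometry.DiscreteGeometry.BachocVallentin

/-- `Σ_{k<6} f k` written out. -/
private theorem sum_range_blocksT11 (f : ℕ → ℝ) : ∑ k ∈ range 6, f k = f 0 + f 1 + f 2 + f 3 + f 4 + f 5 := by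
  simp [Finset.sum_range_succ]

set_option maxRecDepth 20000 in
set_option maxHeartbeats 400000000 in
/-- The last staged partial sum lands on `FexpKT11` (`ring`). -/
theorem fgrp_top_eqT11 (u v t : ℝ) : Facc1KT11 u v t + Fgrp2KT11 u v t = FexpKT11 u v t := by
  unfold Facc1KT11 Fgrp2KT11 FexpKT11
  ring

/-- The tree's factored three-point function (`ThreePointBoundGeneral.threePointF`, `n = 4`) equals `FexpKT11` (blockwise identities
`fblk<k>_eq`, staged sums, `linear_combination`). -/
theorem threePointF_eqT11 (u v t : ℝ) : threePointF 4 6 6 dcoKT11 gwKT11 u v t = FexpKT11 u v t := by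
  rw [threePointF, sum_range_blocksT11, fblk0_eqT11, fblk1_eqT11, fblk2_eqT11, fblk3_eqT11, fblk4_eqT11, fblk5_eqT11]
  linear_combination fgrp0_eqT11 u v t + fgrp1_eqT11 u v t + fgrp2_eqT11 u v t + facc1_eqT11 u v t + fgrp_top_eqT11 u v t

end Summit.Ventures.PackingBounds.Energy.TenPointCkEleven
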